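import Literature.MathematicalPhysics.QuantumFieldTheory.Balaban1983to89.T4TwoRunUniqueness
import Literature.MathematicalPhysics.QuantumFieldTheory.Balaban1983to89.T4BetaStationary
import Summits.QuantumFields.BalabanUV.Gaps.EndTopRunCriterion

/-!
# Gaps / EndTopRunFadingMemory — non-crossing from ONE-SIDED history moduli with FADING MEMORY (the SMALLNESS road to (D)'s `hord`, in NE4's
# letters `T4CouplingMatching.FadingMemory`), and the END criterion under it — a PORT into the tree, with attribution, of g1-plan-2 GEN 17's lens
# kernel `HOME/g1/skeletons/XreadHordFadingMemory_plan2.lean` (sha16 fd1bf8aef26dcb58, §2 ∕ §3 ∕ §8; lens items S-38 ∕ S-41; offered for porting in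
# [G1-PLAN2-G17-S41]) — complementary to this seat's SIGN road `Gaps/EndTopRunCooperative`
# (cell pub-balaban-gaps, seat g1-p3 gen 6, row CAP+tail ∕ β-currency «split ∕ weakening»)

HONEST FRAMING (cell rule, page 1 of everything): [folklore] real analysis (a forward gap recursion with summable memory) over the tree's typed
carriers (`FlowStep.RGEqH` ∕ `Box`, `T4CouplingMatching.FadingMemory`, `DagBinding.ForwardGenerated` ∕ `EndpointExistence`,
`FlowStepRuns.HaltsOutside` ∕ `CurriesHBeta`).  AUTHORSHIP: the mathematics and the Lean text of every declaration below are g1-plan-2 GEN 17's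
(planner seat; planners file nothing on the ledger by mandate — «provers may port»); this seat's contribution is the port (namespace, imports,
this header) and the kernel re-check against the tree.  The one-sided modulus and the fading-memory letter are BINDERS on a history-dependent
β-family — NOT PRINTED structural claims about [I]'s `E^{(j)}` (cf. the docstring of `T4CouplingMatching.FadingMemory`); whether Bałaban's β
meets them is NOT asserted.  `EndpointExistence` appears only inside an equivalence.  NOTHING of Bałaban's is asserted; 0∕6 binders; 0
coefficients certified; one finite T⁴; NOT B12 Thm 2, NOT `BetaPertH`, NOT the continuum limit, NOT Clay.

THE POINT (g1-plan-2 R-33, verbatim in substance).  (D) `EndTopRunCriterion.endpointExistence_iff_topRuns` makes the END binder EXACTLY the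
top-run condition under NON-CROSSING (`hord`).  `EndTopRunCooperative` supplies `hord` by a SIGN structure (cooperative past, increasing step
maps).  Here `hord` comes from SMALLNESS instead: a ONE-SIDED modulus on the ANTI-cooperative excess only — for `v ≤ v′` coordinatewise in the
box, `β_{k+1}(v) − β_{k+1}(v′) ≤ Σ_i Λ_{k,i}(1∕v_i² − 1∕v′_i²)` — with FADING MEMORY `0 ≤ Λ_{k,i} ≤ Cθ^{k−i}` and the smallness `Cρ ≤ (1−ρ)(ρ−θ)`
(`θ < ρ`): the gap `Δ_k = 1∕g_k² − 1∕g′_k²` of two runs obeys the forward recursion `Δ_{k+1} ≥ Δ_k − Σ_i Λ_{k,i}Δ_i` (needed only GIVEN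
`Δ_0,…,Δ_k > 0`, which the induction supplies: `gap_forward_cond`), and summable geometric memory never closes it
(`invSqGap_of_oneSided_fadingMemory`, **`hord_of_oneSided_fadingMemory`**); hence **`endpointExistence_iff_topRuns_of_oneSided`**.  The SIGN
road's uniform version is INSIDE (`oneSided_of_cooperative_diag` ∕ `hord_of_cooperative_diag`: diagonal modulus `Λ_{k,i} = L·[i = k]`, `L < 1`,
the tree's `fadingMemory_diag`; in the g-currency `hord_of_cooperative_lastLipschitz`: `M·γ₀³ < 2`).  So the ORDER letter of the END criterion
is ONE-SIDED: only the anti-cooperative part of β_{k+1}'s dependence on the earlier couplings needs (small, fading) control.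
0 sorry; 0 def; imports `T4TwoRunUniqueness` (for `FadingMemory` ∕ `fadingMemory_diag` via `T4CouplingMatching`, and the corner lemma `abs_sub_le_half_cube`) +
`T4BetaStationary` (`constant_nonneg_of_fadingMemory`) + `Gaps/EndTopRunCriterion`; restates nothing of the tree (the kernel's two helper lemmas that the tree
already had are CITED, not re-declared — gate dedup guard).

CITATION HEADER (tags CONTEXT ONLY).  [I] = T. Bałaban, Commun. Math. Phys. **109** (1987) [Balaban1987RG1]: Thm 2 p. 259, (0.20) p. 256,
§1 p. 263, §5 p. 298 (history dependence of β).
-/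

namespace Summit.QuantumFields.BalabanUV.Gaps.EndTopRunFadingMemory

open Literature.MathematicalPhysics.QuantumFieldTheory.Balaban1983to89
open Literature.MathematicalPhysics.QuantumFieldTheory.Balaban1983to89.FlowStep
open Literature.MathematicalPhysics.QuantumFieldTheory.Balaban1983to89.FlowStepRuns
open Literature.MathematicalPhysics.QuantumFieldTheory.Balaban1983to89.DagBinding
open Literature.MathematicalPhysics.QuantumFieldTheory.Balaban1983to89.T4CouplingMatching
open Summit.QuantumFields.BalabanUV.Gaps.EndRunwiseShooting
open Summit.QuantumFields.BalabanUV.Gaps.EndTopRunCriterion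
open Filter Topology Finset

noncomputable section

/-! ## §1 Geometric memory: the convolution bound and the weighted-sum hypothesis (g1-plan-2 kernel §2, ported) -/

/-- CONVOLUTION BOUND: for `θ ≥ 0`, `(ρ − θ) · Σ_{j≤k} θ^{k−j} ρ^j ≤ ρ^{k+1}` (induction on `k`: `S_{k+1} = θ S_k + ρ^{k+1}`). [folklore] -/
theorem geom_conv_le {θ ρ : ℝ} (hθ : 0 ≤ θ) :
    ∀ k : ℕ, (ρ - θ) * ∑ j ∈ range (k + 1), θ ^ (k - j) * ρ ^ j ≤ ρ ^ (k + 1) := by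
  intro k
  induction k with
  | zero =>
    simp only [zero_add, Finset.sum_range_one, Nat.sub_self, pow_zero, mul_one, pow_one]
    linarith
  | succ k ih =>
    set S := ∑ j ∈ range (k + 1), θ ^ (k - j) * ρ ^ j with hS
    have e : ∑ j ∈ range (k + 1 + 1), θ ^ (k + 1 - j) * ρ ^ j = θ * S + ρ ^ (k + 1) := by
      rw [Finset.sum_range_succ, hS, Finset.mul_sum]
      congr 1
      · refine Finset.sum_congr rfl fun j hj => ?_
        have hjk : j ≤ k := Nat.lt_succ_iff.mp (mem_range.mp hj)
        rw [show k + 1 - j = k - j + 1 by omega, pow_succ]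
        ring
      · simp
    rw [e]
    have ih' : θ * ((ρ - θ) * S) ≤ θ * ρ ^ (k + 1) := mul_le_mul_of_nonneg_left ih hθ
    have expand : (ρ - θ) * (θ * S + ρ ^ (k + 1)) = θ * ((ρ - θ) * S) + (ρ - θ) * ρ ^ (k + 1) := by ring
    rw [expand]
    calc θ * ((ρ - θ) * S) + (ρ - θ) * ρ ^ (k + 1) ≤ θ * ρ ^ (k + 1) + (ρ - θ) * ρ ^ (k + 1) := by linarith
      _ = ρ ^ (k + 1 + 1) := by ring

/-- THE WEIGHTED-SUM HYPOTHESIS OF §1 FROM FADING MEMORY: with `c_{k,j} := A · Λ_{k,j}`, `0 ≤ Λ_{k,j} ≤ C θ^{k−j}` (`0 ≤ θ < ρ`,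
`A ≥ 0`) and the smallness `A · C · ρ ≤ (1 − ρ)(ρ − θ)`: `Σ_{j≤k} c_{k,j} ρ^j ≤ (1 − ρ) ρ^k` for every `k`. [folklore] -/
theorem hsum_of_fadingMemory {C θ ρ A : ℝ} {Λ : ℕ → ℕ → ℝ} (hΛ : FadingMemory C θ Λ) (hθ : 0 ≤ θ) (hθρ : θ < ρ)
    (hA : 0 ≤ A) (hsmall : A * C * ρ ≤ (1 - ρ) * (ρ - θ)) :
    ∀ k : ℕ, ∑ j ∈ range (k + 1), A * Λ k j * ρ ^ j ≤ (1 - ρ) * ρ ^ k := by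
  have hC : 0 ≤ C := T4BetaStationary.constant_nonneg_of_fadingMemory hΛ
  have hρ : 0 < ρ := lt_of_le_of_lt hθ hθρ
  have hρθ : 0 < ρ - θ := sub_pos.mpr hθρ
  intro k
  set S := ∑ j ∈ range (k + 1), θ ^ (k - j) * ρ ^ j with hS
  have h1 : ∑ j ∈ range (k + 1), A * Λ k j * ρ ^ j ≤ A * C * S := by
    rw [hS, Finset.mul_sum]
    refine Finset.sum_le_sum fun j hj => ?_
    have hjk : j ≤ k := Nat.lt_succ_iff.mp (mem_range.mp hj)
    calc A * Λ k j * ρ ^ j = A * ρ ^ j * Λ k j := by ring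
      _ ≤ A * ρ ^ j * (C * θ ^ (k - j)) :=
          mul_le_mul_of_nonneg_left (hΛ k j hjk).2 (mul_nonneg hA (pow_nonneg hρ.le j))
      _ = A * C * (θ ^ (k - j) * ρ ^ j) := by ring
  have h2 : (ρ - θ) * S ≤ ρ ^ (k + 1) := geom_conv_le hθ k
  have h3 : (ρ - θ) * (A * C * S) ≤ (ρ - θ) * ((1 - ρ) * ρ ^ k) := by
    calc (ρ - θ) * (A * C * S) = A * C * ((ρ - θ) * S) := by ring
      _ ≤ A * C * ρ ^ (k + 1) := mul_le_mul_of_nonneg_left h2 (mul_nonneg hA hC)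
      _ = A * C * ρ * ρ ^ k := by ring
      _ ≤ (1 - ρ) * (ρ - θ) * ρ ^ k := mul_le_mul_of_nonneg_right hsmall (pow_nonneg hρ.le k)
      _ = (ρ - θ) * ((1 - ρ) * ρ ^ k) := by ring
  exact h1.trans (le_of_mul_le_mul_left h3 hρθ)

/-! ## §2 One-sided history moduli with fading memory ⟹ non-crossing ⟹ the END criterion (kernel §8, ported) -/

/-- FORWARD GAP LEMMA, CONDITIONAL FORM: as `gap_forward`, but the recursion inequality at step `k` is required only GIVEN
`Δ_0, …, Δ_k > 0` (which the induction itself supplies) — the form a ONE-SIDED difference bound delivers. [folklore] -/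
theorem gap_forward_cond {n : ℕ} {Δ : ℕ → ℝ} {c : ℕ → ℕ → ℝ} {ρ : ℝ} (hρ : 0 < ρ)
    (hc : ∀ k j, j ≤ k → 0 ≤ c k j) (h0 : 0 < Δ 0)
    (hrec : ∀ k, k < n → (∀ j, j ≤ k → 0 < Δ j) → Δ k - ∑ j ∈ range (k + 1), c k j * |Δ j| ≤ Δ (k + 1))
    (hsum : ∀ k, k < n → ∑ j ∈ range (k + 1), c k j * ρ ^ j ≤ (1 - ρ) * ρ ^ k) :
    ∀ k, k ≤ n → ∀ j, j ≤ k → 0 < Δ j ∧ ρ ^ k * Δ j ≤ ρ ^ j * Δ k := by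
  intro k
  induction k with
  | zero =>
    intro _ j hj
    obtain rfl : j = 0 := Nat.le_zero.mp hj
    exact ⟨h0, le_rfl⟩
  | succ k ih =>
    intro hk j hj
    have hkn : k < n := Nat.lt_of_succ_le hk
    have P := ih hkn.le
    have hΔk : 0 < Δ k := (P k le_rfl).1
    have hmem : ∑ j ∈ range (k + 1), c k j * |Δ j| ≤ (1 - ρ) * Δ k := by
      have h1 : ρ ^ k * ∑ j ∈ range (k + 1), c k j * |Δ j| ≤ ρ ^ k * ((1 - ρ) * Δ k) := by
        calc ρ ^ k * ∑ j ∈ range (k + 1), c k j * |Δ j|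
            = ∑ j ∈ range (k + 1), c k j * (ρ ^ k * Δ j) := by
              rw [Finset.mul_sum]
              refine Finset.sum_congr rfl fun j hj => ?_
              rw [abs_of_pos (P j (Nat.lt_succ_iff.mp (mem_range.mp hj))).1]
              ring
          _ ≤ ∑ j ∈ range (k + 1), c k j * (ρ ^ j * Δ k) :=
              Finset.sum_le_sum fun j hj =>
                mul_le_mul_of_nonneg_left (P j (Nat.lt_succ_iff.mp (mem_range.mp hj))).2
                  (hc k j (Nat.lt_succ_iff.mp (mem_range.mp hj)))
          _ = Δ k * ∑ j ∈ range (k + 1), c k j * ρ ^ j := by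
              rw [Finset.mul_sum]
              exact Finset.sum_congr rfl fun j _ => by ring
          _ ≤ Δ k * ((1 - ρ) * ρ ^ k) := mul_le_mul_of_nonneg_left (hsum k hkn) hΔk.le
          _ = ρ ^ k * ((1 - ρ) * Δ k) := by ring
      exact le_of_mul_le_mul_left h1 (pow_pos hρ k)
    have hstep : ρ * Δ k ≤ Δ (k + 1) := by
      have := hrec k hkn fun j hj => (P j hj).1
      linarith
    rcases Nat.lt_or_eq_of_le hj with hlt | rfl
    · have hjk : j ≤ k := Nat.lt_succ_iff.mp hlt
      refine ⟨(P j hjk).1, ?_⟩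
      calc ρ ^ (k + 1) * Δ j = ρ * (ρ ^ k * Δ j) := by ring
        _ ≤ ρ * (ρ ^ j * Δ k) := mul_le_mul_of_nonneg_left (P j hjk).2 hρ.le
        _ = ρ ^ j * (ρ * Δ k) := by ring
        _ ≤ ρ ^ j * Δ (k + 1) := mul_le_mul_of_nonneg_left hstep (pow_nonneg hρ.le j)
    · exact ⟨lt_of_lt_of_le (mul_pos hρ hΔk) hstep, le_rfl⟩

/-- From a positive t-gap back to the couplings: `0 < 1∕x² − 1∕y²` with `y > 0` gives `x < y`. [folklore] -/
theorem lt_of_invSqGap_pos {x y : ℝ} (hy : 0 < y) (h : 0 < 1 / x ^ 2 - 1 / y ^ 2) : x < y := by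
  by_contra hle
  have hle' : y ≤ x := not_lt.mp hle
  have : 1 / x ^ 2 ≤ 1 / y ^ 2 := one_div_le_one_div_of_le (by positivity) (pow_le_pow_left₀ hy.le hle' 2)
  linarith

/-- THE TWO-RUN RECURRENCE FROM ONE-SIDED MODULI: if the two prefixes are ORDERED (`g_j ≤ g′_j`, `j ≤ k`) then the one-sided bound at
`v = g_{≤k} ≤ v′ = g′_{≤k}` gives `Δ_{k+1} ≥ Δ_k − Σ_{j≤k} Λ_{k,j}|Δ_j|` (`Λ ≥ 0`). [cite: Balaban1987RG1, (0.20) p.256] -/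
theorem run_gap_step_oneSided {β : HBeta} {γ γ₀ : ℝ} {Λ : ℕ → ℕ → ℝ} (hγle : γ ≤ γ₀)
    (hOS : ∀ (k : ℕ) (v v' : Fin (k + 1) → ℝ), v ∈ Box γ₀ k → v' ∈ Box γ₀ k → (∀ i, v i ≤ v' i) →
      β k v - β k v' ≤ ∑ i : Fin (k + 1), Λ k i * (1 / (v i) ^ 2 - 1 / (v' i) ^ 2))
    (hΛ0 : ∀ k j, j ≤ k → 0 ≤ Λ k j)
    {n : ℕ} {gs gs' : ℕ → ℝ} (hrg : RGEqH n β gs) (hrg' : RGEqH n β gs')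
    (hI : Step.InInterval γ n gs) (hI' : Step.InInterval γ n gs') {k : ℕ} (hk : k < n)
    (hle : ∀ j, j ≤ k → gs j ≤ gs' j) :
    (1 / (gs k) ^ 2 - 1 / (gs' k) ^ 2)
        - ∑ j ∈ range (k + 1), Λ k j * |1 / (gs j) ^ 2 - 1 / (gs' j) ^ 2|
      ≤ 1 / (gs (k + 1)) ^ 2 - 1 / (gs' (k + 1)) ^ 2 := by
  have e := hrg k hk
  have e' := hrg' k hk
  have hI₀ : ∀ i, i ≤ n → 0 < gs i ∧ gs i ≤ γ₀ := fun i hi => ⟨(hI i hi).1, (hI i hi).2.trans hγle⟩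
  have hI₀' : ∀ i, i ≤ n → 0 < gs' i ∧ gs' i ≤ γ₀ := fun i hi => ⟨(hI' i hi).1, (hI' i hi).2.trans hγle⟩
  have hp : prefixOf gs k ∈ Box γ₀ k := prefixOf_mem_box hk.le hI₀
  have hp' : prefixOf gs' k ∈ Box γ₀ k := prefixOf_mem_box hk.le hI₀'
  have hvv : ∀ i : Fin (k + 1), prefixOf gs k i ≤ prefixOf gs' k i := fun i => by
    simpa only [prefixOf_apply] using hle i (Nat.lt_succ_iff.mp i.isLt)
  have hβ := hOS k _ _ hp hp' hvv
  have hsumle : ∑ i : Fin (k + 1), Λ k i * (1 / (prefixOf gs k i) ^ 2 - 1 / (prefixOf gs' k i) ^ 2)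
      ≤ ∑ j ∈ range (k + 1), Λ k j * |1 / (gs j) ^ 2 - 1 / (gs' j) ^ 2| := by
    rw [← Fin.sum_univ_eq_sum_range (fun j => Λ k j * |1 / (gs j) ^ 2 - 1 / (gs' j) ^ 2|) (k + 1)]
    refine Finset.sum_le_sum fun i _ => ?_
    simp only [prefixOf_apply]
    exact mul_le_mul_of_nonneg_left (le_abs_self _) (hΛ0 k i (Nat.lt_succ_iff.mp i.isLt))
  linarith

/-- QUANTITATIVE NON-CROSSING FROM ONE-SIDED MODULI of fading memory `FadingMemory C θ Λ` (`0 ≤ θ < ρ`) with the §5 smallness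
`C·ρ ≤ (1 − ρ)(ρ − θ)`: two in-interval (level `γ ≤ γ₀`) solutions of (0.20) with `g_0 < g′_0` have `Δ_j > 0` and `Δ_k ≥ ρ^{k−j}Δ_j`
(`j ≤ k ≤ n`) — §1 in its conditional form, the order of the prefixes being read off the positive gaps. [cite: Balaban1987RG1, (0.20) p.256 and §5 p.298] -/
theorem invSqGap_of_oneSided_fadingMemory {β : HBeta} {γ₀ C θ ρ : ℝ} {Λ : ℕ → ℕ → ℝ}
    (hOS : ∀ (k : ℕ) (v v' : Fin (k + 1) → ℝ), v ∈ Box γ₀ k → v' ∈ Box γ₀ k → (∀ i, v i ≤ v' i) →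
      β k v - β k v' ≤ ∑ i : Fin (k + 1), Λ k i * (1 / (v i) ^ 2 - 1 / (v' i) ^ 2))
    (hΛ : FadingMemory C θ Λ) (hθ : 0 ≤ θ) (hθρ : θ < ρ) (hsmall : C * ρ ≤ (1 - ρ) * (ρ - θ))
    {γ : ℝ} (hγle : γ ≤ γ₀) {n : ℕ} {gs gs' : ℕ → ℝ} (hrg : RGEqH n β gs) (hrg' : RGEqH n β gs')
    (hI : Step.InInterval γ n gs) (hI' : Step.InInterval γ n gs') (h0 : gs 0 < gs' 0) :
    ∀ k, k ≤ n → ∀ j, j ≤ k → 0 < 1 / (gs j) ^ 2 - 1 / (gs' j) ^ 2 ∧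
      ρ ^ (k - j) * (1 / (gs j) ^ 2 - 1 / (gs' j) ^ 2) ≤ 1 / (gs k) ^ 2 - 1 / (gs' k) ^ 2 := by
  have hρ : 0 < ρ := lt_of_le_of_lt hθ hθρ
  have hΛ0 : ∀ k j, j ≤ k → 0 ≤ Λ k j := fun k j hjk => (hΛ k j hjk).1
  have hΔ0 : 0 < (fun j => 1 / (gs j) ^ 2 - 1 / (gs' j) ^ 2) 0 := by
    have hp : 0 < gs 0 := (hI 0 (Nat.zero_le _)).1
    have hlt : 1 / (gs' 0) ^ 2 < 1 / (gs 0) ^ 2 :=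
      one_div_lt_one_div_of_lt (by positivity) (by nlinarith [h0, hp])
    show 0 < 1 / (gs 0) ^ 2 - 1 / (gs' 0) ^ 2
    linarith
  have hrec : ∀ k, k < n → (∀ j, j ≤ k → 0 < (fun j => 1 / (gs j) ^ 2 - 1 / (gs' j) ^ 2) j) →
      (fun j => 1 / (gs j) ^ 2 - 1 / (gs' j) ^ 2) k
        - ∑ j ∈ range (k + 1), Λ k j * |(fun j => 1 / (gs j) ^ 2 - 1 / (gs' j) ^ 2) j|
      ≤ (fun j => 1 / (gs j) ^ 2 - 1 / (gs' j) ^ 2) (k + 1) :=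
    fun k hk hpos => run_gap_step_oneSided hγle hOS hΛ0 hrg hrg' hI hI' hk fun j hj =>
      (lt_of_invSqGap_pos (hI' j (hj.trans hk.le)).1 (hpos j hj)).le
  have hsmall' : 1 * C * ρ ≤ (1 - ρ) * (ρ - θ) := by rwa [one_mul]
  have hsum : ∀ k, k < n → ∑ j ∈ range (k + 1), Λ k j * ρ ^ j ≤ (1 - ρ) * ρ ^ k := fun k _ => by
    have h := hsum_of_fadingMemory hΛ hθ hθρ zero_le_one hsmall' k
    simpa only [one_mul] using h
  intro k hk j hj
  have G := gap_forward_cond hρ hΛ0 hΔ0 hrec hsum k hk j hj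
  refine ⟨G.1, ?_⟩
  have h := G.2
  have e : ρ ^ k = ρ ^ j * ρ ^ (k - j) := by rw [← pow_add, Nat.add_sub_cancel' hj]
  rw [e, mul_assoc] at h
  exact le_of_mul_le_mul_left h (pow_pos hρ j)

/-- **`hord` FROM ONE-SIDED MODULI (S-41).**  For `v ≤ v′` coordinatewise in `Box γ₀ k`:
`β_{k+1}(v) − β_{k+1}(v′) ≤ Σ_i Λ_{k,i}(1∕v_i² − 1∕v′_i²)`, with `FadingMemory C θ Λ` (`0 ≤ θ < ρ`) and `C·ρ ≤ (1 − ρ)(ρ − θ)` ⟹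
in-interval runs of (0.20) at every level `γ ≤ γ₀` do not cross — the weakest letter of this kernel's road: a modulus on the
ANTI-cooperative excess only. [cite: Balaban1987RG1, (0.20) p.256 and §5 p.298] -/
theorem hord_of_oneSided_fadingMemory {β : HBeta} {γ₀ C θ ρ : ℝ} {Λ : ℕ → ℕ → ℝ}
    (hOS : ∀ (k : ℕ) (v v' : Fin (k + 1) → ℝ), v ∈ Box γ₀ k → v' ∈ Box γ₀ k → (∀ i, v i ≤ v' i) →
      β k v - β k v' ≤ ∑ i : Fin (k + 1), Λ k i * (1 / (v i) ^ 2 - 1 / (v' i) ^ 2))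
    (hΛ : FadingMemory C θ Λ) (hθ : 0 ≤ θ) (hθρ : θ < ρ) (hsmall : C * ρ ≤ (1 - ρ) * (ρ - θ)) :
    ∀ γ : ℝ, 0 < γ → γ ≤ γ₀ → ∀ (n : ℕ) (gs gs' : ℕ → ℝ), RGEqH n β gs → RGEqH n β gs' →
      Step.InInterval γ n gs → Step.InInterval γ n gs' → gs 0 < gs' 0 → ∀ k, k ≤ n → gs k < gs' k := by
  intro γ _ hγle n gs gs' hrg hrg' hI hI' h0 k hk
  have hΔ := (invSqGap_of_oneSided_fadingMemory hOS hΛ hθ hθρ hsmall hγle hrg hrg' hI hI' h0 k hk k le_rfl).1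
  exact lt_of_invSqGap_pos (hI' k hk).1 hΔ

/-- THE SIGN ROAD IS INSIDE (uniform version): `β_{k+1}` COOPERATIVE in the earlier couplings (INTENT-7's hypothesis (ii), verbatim)
and ONE-SIDED t-Lipschitz in the last one with ONE constant `L` — `β_{k+1}(v|x) − β_{k+1}(v|y) ≤ L(1∕x² − 1∕y²)` for `0 < x ≤ y ≤ γ₀` —
give the one-sided bound with the DIAGONAL modulus `Λ_{k,i} = L·[i = k]` (compare through `w = v′|_{last := v_k}`, as INTENT-7 does).
[folklore] -/
theorem oneSided_of_cooperative_diag {β : HBeta} {γ₀ L : ℝ}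
    (hcoop : ∀ (k : ℕ) (v v' : Fin (k + 1) → ℝ), v ∈ Box γ₀ k → v' ∈ Box γ₀ k → (∀ i, v i ≤ v' i) →
      v (Fin.last k) = v' (Fin.last k) → β k v ≤ β k v')
    (hdiag : ∀ (k : ℕ) (v : Fin (k + 1) → ℝ), v ∈ Box γ₀ k → ∀ x y : ℝ, 0 < x → x ≤ y → y ≤ γ₀ →
      β k (Function.update v (Fin.last k) x) - β k (Function.update v (Fin.last k) y) ≤ L * (1 / x ^ 2 - 1 / y ^ 2)) :
    ∀ (k : ℕ) (v v' : Fin (k + 1) → ℝ), v ∈ Box γ₀ k → v' ∈ Box γ₀ k → (∀ i, v i ≤ v' i) →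
      β k v - β k v' ≤ ∑ i : Fin (k + 1), (fun (a : ℕ) (b : ℕ) => if b = a then L else 0) k i * (1 / (v i) ^ 2 - 1 / (v' i) ^ 2) := by
  intro k v v' hv hv' hle
  have hv0 := mem_box.mp hv
  have hv0' := mem_box.mp hv'
  -- the intermediate prefix: earlier couplings of the larger history, last coupling of the smaller
  have hwbox : Function.update v' (Fin.last k) (v (Fin.last k)) ∈ Box γ₀ k := by
    rw [mem_box]
    intro i
    by_cases hi : i = Fin.last k
    · subst hi
      rw [Function.update_self]
      exact hv0 (Fin.last k)
    · rw [Function.update_of_ne hi]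
      exact hv0' i
  have h1 : β k v ≤ β k (Function.update v' (Fin.last k) (v (Fin.last k))) := by
    refine hcoop k v _ hv hwbox (fun i => ?_) (by rw [Function.update_self])
    by_cases hi : i = Fin.last k
    · subst hi
      rw [Function.update_self]
    · rw [Function.update_of_ne hi]
      exact hle i
  have h2 : β k (Function.update v' (Fin.last k) (v (Fin.last k))) - β k v'
      ≤ L * (1 / (v (Fin.last k)) ^ 2 - 1 / (v' (Fin.last k)) ^ 2) := by
    have h := hdiag k v' hv' (v (Fin.last k)) (v' (Fin.last k)) (hv0 _).1 (hle _) (hv0' _).2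
    rwa [Function.update_eq_self] at h
  have hsum : ∑ i : Fin (k + 1), (fun (a : ℕ) (b : ℕ) => if b = a then L else 0) k i * (1 / (v i) ^ 2 - 1 / (v' i) ^ 2)
      = L * (1 / (v (Fin.last k)) ^ 2 - 1 / (v' (Fin.last k)) ^ 2) := by
    rw [Fin.sum_univ_castSucc]
    have hz : ∑ i : Fin k, (fun (a : ℕ) (b : ℕ) => if b = a then L else 0) k ((Fin.castSucc i : Fin (k + 1)) : ℕ)
        * (1 / (v (Fin.castSucc i)) ^ 2 - 1 / (v' (Fin.castSucc i)) ^ 2) = 0 := by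
      refine Finset.sum_eq_zero fun i _ => ?_
      have hne : (i : ℕ) ≠ k := Nat.ne_of_lt i.isLt
      simp [hne]
    rw [hz, zero_add]
    simp
  linarith [h1, h2, hsum.le, hsum.ge]

/-- **`hord` BY THE SIGN ROAD, uniform version** — INTENT-7's (ii) + one-sided t-Lipschitz last coupling with `0 ≤ L < 1`: the diagonal
modulus has fading memory with rate `θ = 0` (`fadingMemory_diag`) and the smallness holds with `ρ = 1 − L` (equality). [cite: Balaban1987RG1, (0.20) p.256 and §5 p.298] -/
theorem hord_of_cooperative_diag {β : HBeta} {γ₀ L : ℝ}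
    (hcoop : ∀ (k : ℕ) (v v' : Fin (k + 1) → ℝ), v ∈ Box γ₀ k → v' ∈ Box γ₀ k → (∀ i, v i ≤ v' i) →
      v (Fin.last k) = v' (Fin.last k) → β k v ≤ β k v')
    (hdiag : ∀ (k : ℕ) (v : Fin (k + 1) → ℝ), v ∈ Box γ₀ k → ∀ x y : ℝ, 0 < x → x ≤ y → y ≤ γ₀ →
      β k (Function.update v (Fin.last k) x) - β k (Function.update v (Fin.last k) y) ≤ L * (1 / x ^ 2 - 1 / y ^ 2))
    (hL0 : 0 ≤ L) (hL1 : L < 1) :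
    ∀ γ : ℝ, 0 < γ → γ ≤ γ₀ → ∀ (n : ℕ) (gs gs' : ℕ → ℝ), RGEqH n β gs → RGEqH n β gs' →
      Step.InInterval γ n gs → Step.InInterval γ n gs' → gs 0 < gs' 0 → ∀ k, k ≤ n → gs k < gs' k :=
  hord_of_oneSided_fadingMemory (Λ := fun a b => if b = a then L else 0) (C := L) (θ := 0) (ρ := 1 - L)
    (oneSided_of_cooperative_diag hcoop hdiag) (fadingMemory_diag hL0 le_rfl) le_rfl (by linarith) (le_of_eq (by ring))

/-- … and in the g-currency: cooperative past + Lipschitz constant `M` in the last coupling with `M·γ₀³ < 2` ((D)'s Markov threshold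
`anti_of_lipschitz`, with «Markov» replaced by «cooperative») ⟹ `hord` — by the corner conversion `|x − y| ≤ (γ₀³∕2)|1∕x² − 1∕y²|`
(`T4TwoRunUniqueness.abs_sub_le_half_cube`), `L = M·γ₀³∕2 < 1`. [cite: Balaban1987RG1, (0.20) p.256 and §1 p.263] -/
theorem hord_of_cooperative_lastLipschitz {β : HBeta} {γ₀ M : ℝ} (hγ₀ : 0 < γ₀)
    (hcoop : ∀ (k : ℕ) (v v' : Fin (k + 1) → ℝ), v ∈ Box γ₀ k → v' ∈ Box γ₀ k → (∀ i, v i ≤ v' i) →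
      v (Fin.last k) = v' (Fin.last k) → β k v ≤ β k v')
    (hlast : ∀ (k : ℕ) (v : Fin (k + 1) → ℝ), v ∈ Box γ₀ k → ∀ x y : ℝ, 0 < x → x ≤ γ₀ → 0 < y → y ≤ γ₀ →
      |β k (Function.update v (Fin.last k) x) - β k (Function.update v (Fin.last k) y)| ≤ M * |x - y|)
    (hM : 0 ≤ M) (hsmall : M * γ₀ ^ 3 < 2) :
    ∀ γ : ℝ, 0 < γ → γ ≤ γ₀ → ∀ (n : ℕ) (gs gs' : ℕ → ℝ), RGEqH n β gs → RGEqH n β gs' →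
      Step.InInterval γ n gs → Step.InInterval γ n gs' → gs 0 < gs' 0 → ∀ k, k ≤ n → gs k < gs' k := by
  refine hord_of_cooperative_diag (L := M * γ₀ ^ 3 / 2) hcoop (fun k v hv x y hx hxy hyγ => ?_) (by positivity) (by linarith)
  have hy : 0 < y := lt_of_lt_of_le hx hxy
  have hxγ : x ≤ γ₀ := hxy.trans hyγ
  have h1 := hlast k v hv x y hx hxγ hy hyγ
  have h2 := T4TwoRunUniqueness.abs_sub_le_half_cube hx hxγ hy hyγ
  have hnn : 0 ≤ 1 / x ^ 2 - 1 / y ^ 2 := by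
    have := one_div_le_one_div_of_le (pow_pos hx 2) (pow_le_pow_left₀ hx.le hxy 2)
    linarith
  rw [abs_of_nonneg hnn] at h2
  calc β k (Function.update v (Fin.last k) x) - β k (Function.update v (Fin.last k) y)
      ≤ |β k (Function.update v (Fin.last k) x) - β k (Function.update v (Fin.last k) y)| := le_abs_self _
    _ ≤ M * |x - y| := h1
    _ ≤ M * (γ₀ ^ 3 / 2 * (1 / x ^ 2 - 1 / y ^ 2)) := mul_le_mul_of_nonneg_left h2 hM
    _ = M * γ₀ ^ 3 / 2 * (1 / x ^ 2 - 1 / y ^ 2) := by ring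

/-- **THE END CRITERION UNDER ONE-SIDED MODULI (R-33).**  Forward-generated, halting, currying construction; `β ≤ β′` and (C)
`BetaContH γ₀ β` on the box (a LETTER again: one-sided moduli give no continuity); one-sided moduli of fading memory with the §5
smallness ⟹ `EndpointExistence C ↔` the top-run condition ((D)'s iff with `hord` discharged by `hord_of_oneSided_fadingMemory`). [cite: Balaban1987RG1, Thm 2 p.259 and §5 p.298] -/
theorem endpointExistence_iff_topRuns_of_oneSided {Cn : B12.Construction} {β : HBeta}
    (hgen : ForwardGenerated Cn β) (hhalt : HaltsOutside Cn β) (hcur : CurriesHBeta Cn β)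
    {γ₀ β' C θ ρ : ℝ} {Λ : ℕ → ℕ → ℝ} (hγ₀ : 0 < γ₀) (hβ' : 0 ≤ β')
    (hcont : BetaContH γ₀ β) (hhi : BetaUpperH β' γ₀ β)
    (hOS : ∀ (k : ℕ) (v v' : Fin (k + 1) → ℝ), v ∈ Box γ₀ k → v' ∈ Box γ₀ k → (∀ i, v i ≤ v' i) →
      β k v - β k v' ≤ ∑ i : Fin (k + 1), Λ k i * (1 / (v i) ^ 2 - 1 / (v' i) ^ 2))
    (hΛ : FadingMemory C θ Λ) (hθ : 0 ≤ θ) (hθρ : θ < ρ) (hsmall : C * ρ ≤ (1 - ρ) * (ρ - θ)) :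
    EndpointExistence Cn ↔
      ∃ γ₂ : ℝ, 0 < γ₂ ∧ ∀ γ : ℝ, 0 < γ → γ ≤ γ₂ → ∃ gstar : ℝ, 0 < gstar ∧
        ∀ (n : ℕ) (gs : ℕ → ℝ), RGEqH n β gs → Step.InInterval γ n gs → ∀ k, k ≤ n → gs k = γ → gstar ≤ gs n :=
  endpointExistence_iff_topRuns hgen hhalt hcur hγ₀ hβ' hcont hhi (hord_of_oneSided_fadingMemory hOS hΛ hθ hθρ hsmall)

end

end Summit.QuantumFields.BalabanUV.Gaps.EndTopRunFadingMemory
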